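import Summits.KontsevichZagierPeriods.KontsevichZagierPeriods.Theorems.TerasomaMultiplicationMultiplicationAccessibleCornerStokesYFibre

/-!
# `MultiplicationAccessible` (stmt-KontsevichZagierPeriods-12305), line `shifted-family-prime-sieve`:
the `y`-derivative of the corner Stokes component `c₂` (`p = 3`) and its uniform bound

Continuation of `…CornerStokesYFibre`: at an interior point of a `y`-fibre of the chart domain the
fibre function `F(a) = c₂(θ, a, v)` is differentiable, with derivative bounded by the constant
`9^{3s}(1000 s + 3x)` depending only on the exponents (`x ≥ 2`, `s ≥ 3`).  This is the
integrability input of the `y`-direction Newton–Leibniz move `cornerStokesY` (rule (3) of the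
Kontsevich–Zagier calculus needs the fibrewise derivative absolutely integrable on the band).
The proof is the product/chain rule; the poles `1/t_k` of `∂_y M_j` and of `∂_y ζ` are absorbed by
the monomials (`M_j ≤ t₀t₁t₂` for `x ≥ 2`), and `H = (1 + ζ + ζ²)/S ≤ 9` because `S ≥ 1/3`.
Also recorded: elementary facts about the fibre bound `b = min (1/θ₀, 1/θ₁, 1/θ₂)` of the move
(`b_props`, `box_nonneg`, `le_b_of_lt`, `mem_W_iff`).

References: M. Kontsevich, D. Zagier, *Periods* (2001), §1.2 rule (3).
-/

open Set Real

namespace Summit.KontsevichZagierPeriods.TerasomaMultiplication.MultiplicationAccessible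

namespace CornerY

set_option maxHeartbeats 400000 in
/-- **The fibre derivative of `c₂` along `y` and its uniform bound.**  At an interior point `y` of a
`y`-fibre of the chart domain (`θ_k > 0`, `Σθ_k = 1`, `0 < y`, `yθ_k < 1`, `0 < v < 1`) the fibre
function `F = v^{3x-1}(1 - vZ)^{3s-1}((1+Z+Z²)/S)^{3s}(θ₀θ₁θ₂)^{s-1}(θ₀M₀+θ₁M₁+θ₂M₂)` has a
derivative bounded by `9^{3s}(1000 s + 3x)` (`x ≥ 2`, `s ≥ 3`): product and chain rule, every
factor being bounded once the poles `1/t_k` of `∂_y M_j`, `∂_y Z` are absorbed by `M_j ≤ t₀t₁t₂`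
(`S ≥ 1/3`, `H ≤ 9`). [cite: KontsevichZagier2001, §1.2 rule (3)] -/
theorem fibre {x s θ₀ θ₁ θ₂ v y : ℝ} (hx : 2 ≤ x) (hs : 3 ≤ s)
    (hθ₀ : 0 < θ₀) (hθ₁ : 0 < θ₁) (hθ₂ : 0 < θ₂) (hθ : θ₀ + θ₁ + θ₂ = 1)
    (hy : 0 < y) (hy₀ : y * θ₀ < 1) (hy₁ : y * θ₁ < 1) (hy₂ : y * θ₂ < 1)
    (hv₀ : 0 < v) (hv₁ : v < 1) (Zf Sf M0f M1f M2f F : ℝ → ℝ)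
    (hZf : ∀ a, Zf a = ((1 - a * θ₀) * (1 - a * θ₁) * (1 - a * θ₂)) ^ ((1:ℝ) / 3))
    (hSf : ∀ a, Sf a = 1 - a * (θ₀ * θ₁ + θ₀ * θ₂ + θ₁ * θ₂) + a ^ 2 * (θ₀ * θ₁ * θ₂))
    (hM0f : ∀ a, M0f a =
      (1 - a * θ₀) ^ x * (1 - a * θ₁) ^ (x - 2 / 3) * (1 - a * θ₂) ^ (x - 1 / 3))
    (hM1f : ∀ a, M1f a =
      (1 - a * θ₀) ^ (x - 1 / 3) * (1 - a * θ₁) ^ x * (1 - a * θ₂) ^ (x - 2 / 3))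
    (hM2f : ∀ a, M2f a =
      (1 - a * θ₀) ^ (x - 2 / 3) * (1 - a * θ₁) ^ (x - 1 / 3) * (1 - a * θ₂) ^ x)
    (hF : ∀ a, F a = v ^ (3 * x - 1) * (1 - v * Zf a) ^ (3 * s - 1) *
      ((1 + Zf a + Zf a ^ 2) / Sf a) ^ (3 * s) * (θ₀ * θ₁ * θ₂) ^ (s - 1) *
      (θ₀ * M0f a + θ₁ * M1f a + θ₂ * M2f a)) :
    ∃ D, HasDerivAt F D y ∧ |D| ≤ (9:ℝ) ^ (3 * s) * (1000 * s + 3 * x) := by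
  -- positivity at `y` (explicit spelling, used by the calculus lemmas)
  have h0 : 0 < 1 - y * θ₀ := by linarith
  have h1 : 0 < 1 - y * θ₁ := by linarith
  have h2 : 0 < 1 - y * θ₂ := by linarith
  have hp0 : 0 < (1 - y * θ₀) * (1 - y * θ₁) * (1 - y * θ₂) := by positivity
  have hS3e : 1 / 3 ≤ Sf y := by
    rw [hSf]; exact third_le_S hθ hθ₀.le hθ₁.le hθ₂.le hy.le h0.le h1.le h2.le
  have hSy : 0 < Sf y := by linarith
  have hZ0e : 0 < Zf y := by rw [hZf]; exact rpow_pos_of_pos hp0 _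
  have hHq : 0 < (1 + Zf y + Zf y ^ 2) / Sf y := by positivity
  have hZ1e : Zf y ≤ 1 := by
    rw [hZf]
    refine rpow_le_one hp0.le ?_ (by norm_num)
    have ha : 1 - y * θ₀ ≤ 1 := by have := mul_pos hy hθ₀; linarith
    have hb : 1 - y * θ₁ ≤ 1 := by have := mul_pos hy hθ₁; linarith
    have hc : 1 - y * θ₂ ≤ 1 := by have := mul_pos hy hθ₂; linarith
    exact mul_le_one₀ (mul_le_one₀ ha h1.le hb) h2.le hc
  have hG : 0 < 1 - v * Zf y := by
    have := mul_le_mul_of_nonneg_left hZ1e hv₀.le; linarith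
  -- the values at `y`, as opaque atoms
  obtain ⟨t0, ht0⟩ : ∃ t, 1 - y * θ₀ = t := ⟨_, rfl⟩
  obtain ⟨t1, ht1⟩ : ∃ t, 1 - y * θ₁ = t := ⟨_, rfl⟩
  obtain ⟨t2, ht2⟩ : ∃ t, 1 - y * θ₂ = t := ⟨_, rfl⟩
  obtain ⟨Z, hZv⟩ : ∃ e, Zf y = e := ⟨_, rfl⟩
  obtain ⟨Sv, hSv⟩ : ∃ e, Sf y = e := ⟨_, rfl⟩
  obtain ⟨m0, hm0⟩ : ∃ e, M0f y = e := ⟨_, rfl⟩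
  obtain ⟨m1, hm1⟩ : ∃ e, M1f y = e := ⟨_, rfl⟩
  obtain ⟨m2, hm2⟩ : ∃ e, M2f y = e := ⟨_, rfl⟩
  have h0' : 0 < t0 := ht0 ▸ h0
  have h1' : 0 < t1 := ht1 ▸ h1
  have h2' : 0 < t2 := ht2 ▸ h2
  have ht0' : t0 ≤ 1 := by have := mul_pos hy hθ₀; linarith
  have ht1' : t1 ≤ 1 := by have := mul_pos hy hθ₁; linarith
  have ht2' : t2 ≤ 1 := by have := mul_pos hy hθ₂; linarith
  have hp : 0 < t0 * t1 * t2 := by positivity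
  have hp1 : t0 * t1 * t2 ≤ 1 := mul_le_one₀ (mul_le_one₀ ht0' h1'.le ht1') h2'.le ht2'
  have hZ0 : 0 < Z := hZv ▸ hZ0e
  have hZ1 : Z ≤ 1 := hZv ▸ hZ1e
  have hS3 : 1 / 3 ≤ Sv := hSv ▸ hS3e
  have hS0 : 0 < Sv := by linarith
  have hG' : 0 < 1 - v * Z := hZv ▸ hG
  have hG1 : 1 - v * Z ≤ 1 := by have := mul_pos hv₀ hZ0; linarith
  have hy3 : y ≤ 3 := y_le_three hθ hy₀.le hy₁.le hy₂.le
  have hx0 : 0 ≤ x := by linarith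
  have hx1 : 1 ≤ x := by linarith
  have hx2 : 1 ≤ x - 2 / 3 := by linarith
  have hx3 : 1 ≤ x - 1 / 3 := by linarith
  have hm0b : 0 ≤ m0 ∧ m0 ≤ t0 * t1 * t2 := by
    rw [← hm0, hM0f, ht0, ht1, ht2]; exact monomial_le h0'.le ht0' h1'.le ht1' h2'.le ht2' hx1 hx2 hx3
  have hm1b : 0 ≤ m1 ∧ m1 ≤ t0 * t1 * t2 := by
    rw [← hm1, hM1f, ht0, ht1, ht2]; exact monomial_le h0'.le ht0' h1'.le ht1' h2'.le ht2' hx3 hx1 hx2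
  have hm2b : 0 ≤ m2 ∧ m2 ≤ t0 * t1 * t2 := by
    rw [← hm2, hM2f, ht0, ht1, ht2]; exact monomial_le h0'.le ht0' h1'.le ht1' h2'.le ht2' hx2 hx3 hx1
  obtain ⟨hm00, hm0p⟩ := hm0b
  obtain ⟨hm10, hm1p⟩ := hm1b
  obtain ⟨hm20, hm2p⟩ := hm2b
  -- derivative atoms
  obtain ⟨pd, hpd⟩ : ∃ e, -(θ₀ * (t1 * t2) + θ₁ * (t0 * t2) + θ₂ * (t0 * t1)) = e := ⟨_, rfl⟩
  obtain ⟨Zd, hZd⟩ : ∃ e, Z * pd / (3 * (t0 * t1 * t2)) = e := ⟨_, rfl⟩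
  obtain ⟨Sd, hSd⟩ : ∃ e, -(θ₀ * θ₁ + θ₀ * θ₂ + θ₁ * θ₂) + 2 * y * (θ₀ * θ₁ * θ₂) = e :=
    ⟨_, rfl⟩
  obtain ⟨N, hN⟩ : ∃ e, 1 + Z + Z ^ 2 = e := ⟨_, rfl⟩
  obtain ⟨Hd, hHd⟩ : ∃ e, ((1 + 2 * Z) * Zd * Sv - N * Sd) / Sv ^ 2 = e := ⟨_, rfl⟩
  obtain ⟨m0d, hm0d⟩ : ∃ e,
    -(m0 * (x * θ₀ / t0 + (x - 2 / 3) * θ₁ / t1 + (x - 1 / 3) * θ₂ / t2)) = e := ⟨_, rfl⟩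
  obtain ⟨m1d, hm1d⟩ : ∃ e,
    -(m1 * ((x - 1 / 3) * θ₀ / t0 + x * θ₁ / t1 + (x - 2 / 3) * θ₂ / t2)) = e := ⟨_, rfl⟩
  obtain ⟨m2d, hm2d⟩ : ∃ e,
    -(m2 * ((x - 2 / 3) * θ₀ / t0 + (x - 1 / 3) * θ₁ / t1 + x * θ₂ / t2)) = e := ⟨_, rfl⟩
  obtain ⟨E, hE⟩ : ∃ e, v ^ (3 * x - 1) = e := ⟨_, rfl⟩
  obtain ⟨k, hk⟩ : ∃ e, (θ₀ * θ₁ * θ₂) ^ (s - 1) = e := ⟨_, rfl⟩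
  obtain ⟨Ga, hGa⟩ : ∃ e, (1 - v * Z) ^ (3 * s - 1) = e := ⟨_, rfl⟩
  obtain ⟨Gb, hGb⟩ : ∃ e, (1 - v * Z) ^ (3 * s - 2) = e := ⟨_, rfl⟩
  obtain ⟨Ha, hHa⟩ : ∃ e, (N / Sv) ^ (3 * s) = e := ⟨_, rfl⟩
  obtain ⟨Hb, hHb⟩ : ∃ e, (N / Sv) ^ (3 * s - 1) = e := ⟨_, rfl⟩
  obtain ⟨B, hB⟩ : ∃ e, θ₀ * m0 + θ₁ * m1 + θ₂ * m2 = e := ⟨_, rfl⟩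
  obtain ⟨Bd, hBd⟩ : ∃ e, θ₀ * m0d + θ₁ * m1d + θ₂ * m2d = e := ⟨_, rfl⟩
  -- the calculus
  have dZ : HasDerivAt Zf Zd y := by
    refine (hasDerivAt_geomMean hp0 Zf hZf).congr_deriv ?_
    rw [hZv, ht0, ht1, ht2, ← hZd, ← hpd]
  have dS : HasDerivAt Sf Sd y := (hasDerivAt_S (y := y) Sf hSf).congr_deriv hSd
  have dN : HasDerivAt (fun a => 1 + Zf a + Zf a ^ 2) ((1 + 2 * Z) * Zd) y := by
    refine ((dZ.const_add 1).fun_add (dZ.fun_pow 2)).congr_deriv ?_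
    rw [hZv]; push_cast; ring
  have dH : HasDerivAt (fun a => (1 + Zf a + Zf a ^ 2) / Sf a) Hd y := by
    refine (dN.fun_div dS hSy.ne').congr_deriv ?_
    rw [hZv, hSv, hN, hHd]
  have dHp : HasDerivAt (fun a => ((1 + Zf a + Zf a ^ 2) / Sf a) ^ (3 * s))
      (Hd * (3 * s) * Hb) y := by
    refine (dH.rpow_const (p := 3 * s) (Or.inl hHq.ne')).congr_deriv ?_
    rw [hZv, hSv, hN, hHb]
  have dG : HasDerivAt (fun a => (1 - v * Zf a) ^ (3 * s - 1))
      (-(v * Zd) * (3 * s - 1) * Gb) y := by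
    refine (((dZ.const_mul v).const_sub 1).rpow_const (p := 3 * s - 1) (Or.inl hG.ne')).congr_deriv
      ?_
    rw [show 3 * s - 1 - 1 = 3 * s - 2 by ring, hZv, hGb]
  have dM0 : HasDerivAt M0f m0d y := by
    refine (hasDerivAt_monomial h0 h1 h2 M0f hM0f).congr_deriv ?_
    rw [hm0, ht0, ht1, ht2, ← hm0d]
  have dM1 : HasDerivAt M1f m1d y := by
    refine (hasDerivAt_monomial h0 h1 h2 M1f hM1f).congr_deriv ?_
    rw [hm1, ht0, ht1, ht2, ← hm1d]
  have dM2 : HasDerivAt M2f m2d y := by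
    refine (hasDerivAt_monomial h0 h1 h2 M2f hM2f).congr_deriv ?_
    rw [hm2, ht0, ht1, ht2, ← hm2d]
  have dB : HasDerivAt (fun a => θ₀ * M0f a + θ₁ * M1f a + θ₂ * M2f a) Bd y :=
    (((dM0.const_mul θ₀).fun_add (dM1.const_mul θ₁)).fun_add (dM2.const_mul θ₂)).congr_deriv hBd
  have dP : HasDerivAt (fun a => v ^ (3 * x - 1) * (1 - v * Zf a) ^ (3 * s - 1) *
      ((1 + Zf a + Zf a ^ 2) / Sf a) ^ (3 * s) * (θ₀ * θ₁ * θ₂) ^ (s - 1))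
      (E * k * (-(v * Zd) * (3 * s - 1) * Gb * Ha + Ga * (Hd * (3 * s) * Hb))) y := by
    refine (((dG.const_mul (v ^ (3 * x - 1))).fun_mul dHp).mul_const
      ((θ₀ * θ₁ * θ₂) ^ (s - 1))).congr_deriv ?_
    rw [hZv, hSv, hN, hGa, hHa, hE, hk]; ring
  refine ⟨-(E * k * (3 * s - 1) * Gb * v * Ha) * (Zd * B) + E * k * (3 * s) * Ga * Hb * (Hd * B) +
    E * Ga * Ha * k * Bd, ?_, ?_⟩
  · refine ((dP.fun_mul dB).congr_of_eventuallyEq (Filter.Eventually.of_forall hF)).congr_deriv ?_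
    rw [hZv, hSv, hN, hm0, hm1, hm2, hGa, hHa, hE, hk, hB]; ring
  -- the bound: ranges of the atoms
  have hE0 : 0 ≤ E := by rw [← hE]; positivity
  have hE1 : E ≤ 1 := by rw [← hE]; exact rpow_le_one hv₀.le hv₁.le (by linarith)
  have hθp1 : θ₀ * θ₁ * θ₂ ≤ 1 :=
    mul_le_one₀ (mul_le_one₀ (by linarith) hθ₁.le (by linarith)) hθ₂.le (by linarith)
  have hk0 : 0 ≤ k := by rw [← hk]; positivity
  have hk1 : k ≤ 1 := by rw [← hk]; exact rpow_le_one (by positivity) hθp1 (by linarith)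
  have hGa0 : 0 ≤ Ga := by rw [← hGa]; exact rpow_nonneg hG'.le _
  have hGa1 : Ga ≤ 1 := by rw [← hGa]; exact rpow_le_one hG'.le hG1 (by linarith)
  have hGb0 : 0 ≤ Gb := by rw [← hGb]; exact rpow_nonneg hG'.le _
  have hGb1 : Gb ≤ 1 := by rw [← hGb]; exact rpow_le_one hG'.le hG1 (by linarith)
  have hZsq0 : 0 ≤ Z ^ 2 := sq_nonneg Z
  have hZsq1 : Z ^ 2 ≤ 1 := pow_le_one₀ hZ0.le hZ1
  have hN1 : 1 ≤ N := by rw [← hN]; linarith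
  have hN3 : N ≤ 3 := by rw [← hN]; linarith
  have hH0 : 0 ≤ N / Sv := by positivity
  have hH9 : N / Sv ≤ 9 := by rw [div_le_iff₀ hS0]; linarith
  have hHa0 : 0 ≤ Ha := by rw [← hHa]; positivity
  have hHaQ : Ha ≤ (9:ℝ) ^ (3 * s) := by rw [← hHa]; exact Real.rpow_le_rpow hH0 hH9 (by linarith)
  have hHb0 : 0 ≤ Hb := by rw [← hHb]; positivity
  have hHbQ : Hb ≤ (9:ℝ) ^ (3 * s) := by
    rw [← hHb]
    exact (Real.rpow_le_rpow hH0 hH9 (by linarith)).trans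
      (Real.rpow_le_rpow_of_exponent_le (by norm_num) (by linarith))
  have hB0 : 0 ≤ B := by rw [← hB]; positivity
  have hBp : B ≤ t0 * t1 * t2 := by
    rw [← hB]
    have a0 := mul_le_mul_of_nonneg_left hm0p hθ₀.le
    have a1 := mul_le_mul_of_nonneg_left hm1p hθ₁.le
    have a2 := mul_le_mul_of_nonneg_left hm2p hθ₂.le
    have : θ₀ * (t0 * t1 * t2) + θ₁ * (t0 * t1 * t2) + θ₂ * (t0 * t1 * t2) = t0 * t1 * t2 := by
      linear_combination (t0 * t1 * t2) * hθ
    linarith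
  have hpd1 : |pd| ≤ 1 := by
    rw [← hpd, abs_neg, abs_of_nonneg (by positivity)]
    have a0 := mul_le_of_le_one_right hθ₀.le (mul_le_one₀ ht1' h2'.le ht2')
    have a1 := mul_le_of_le_one_right hθ₁.le (mul_le_one₀ ht0' h2'.le ht2')
    have a2 := mul_le_of_le_one_right hθ₂.le (mul_le_one₀ ht0' h1'.le ht1')
    linarith
  have hSd9 : |Sd| ≤ 9 := by
    rw [← hSd, abs_le]
    have e1 : 0 ≤ θ₀ * θ₁ + θ₀ * θ₂ + θ₁ * θ₂ := by positivity
    have e01 : θ₀ * θ₁ ≤ 1 := mul_le_one₀ (by linarith) hθ₁.le (by linarith)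
    have e02 : θ₀ * θ₂ ≤ 1 := mul_le_one₀ (by linarith) hθ₂.le (by linarith)
    have e12 : θ₁ * θ₂ ≤ 1 := mul_le_one₀ (by linarith) hθ₂.le (by linarith)
    have e3 : 0 ≤ y * (θ₀ * θ₁ * θ₂) := by positivity
    have e4 : y * (θ₀ * θ₁ * θ₂) ≤ 3 * 1 := mul_le_mul hy3 hθp1 (by positivity) (by norm_num)
    constructor <;> linarith
  obtain ⟨hZB, hHB⟩ := abs_ZB_HB_le hZ0 hZ1 hpd1 hp hB0 hBp hp1 hS3 hN1 hN3 hSd9 hZd hHd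
  have hBd1 : |Bd| ≤ x := by
    have b0 := abs_logDeriv_le hθ hθ₀.le hθ₁.le hθ₂.le h0' h1' h2' ht0' ht1' ht2' hm00 hm0p
      hx0 le_rfl (by linarith) (by linarith) (by linarith) (by linarith)
      (c0 := x) (c1 := x - 2 / 3) (c2 := x - 1 / 3)
    have b1 := abs_logDeriv_le hθ hθ₀.le hθ₁.le hθ₂.le h0' h1' h2' ht0' ht1' ht2' hm10 hm1p
      (by linarith) (by linarith) hx0 le_rfl (by linarith) (by linarith)
      (c0 := x - 1 / 3) (c1 := x) (c2 := x - 2 / 3)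
    have b2 := abs_logDeriv_le hθ hθ₀.le hθ₁.le hθ₂.le h0' h1' h2' ht0' ht1' ht2' hm20 hm2p
      (by linarith) (by linarith) (by linarith) (by linarith) hx0 le_rfl
      (c0 := x - 2 / 3) (c1 := x - 1 / 3) (c2 := x)
    rw [hm0d] at b0
    rw [hm1d] at b1
    rw [hm2d] at b2
    rw [← hBd]
    calc |θ₀ * m0d + θ₁ * m1d + θ₂ * m2d| ≤ |θ₀ * m0d| + |θ₁ * m1d| + |θ₂ * m2d| :=
        abs_add_three _ _ _
      _ = θ₀ * |m0d| + θ₁ * |m1d| + θ₂ * |m2d| := by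
        rw [abs_mul, abs_mul, abs_mul, abs_of_pos hθ₀, abs_of_pos hθ₁, abs_of_pos hθ₂]
      _ ≤ θ₀ * x + θ₁ * x + θ₂ * x := by gcongr
      _ = x := by linear_combination x * hθ
  exact three_terms_le hs hx0 hv₀.le hv₁.le hE0 hE1 hk0 hk1 hGa0 hGa1 hGb0 hGb1 (by positivity)
    hHa0 hHaQ hHb0 hHbQ hZB hHB hBd1

/-- `min` through `|·|` (for semialgebraicity of the upper fibre bound). [folklore] -/
theorem min_eq_half (a b : ℝ) : min a b = (a + b - |a - b|) / 2 := by
  rcases le_total a b with h | h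
  · rw [min_eq_left h, abs_of_nonpos (by linarith)]; ring
  · rw [min_eq_right h, abs_of_nonneg (by linarith)]; ring

/-- Elementary facts about the upper fibre bound `b = min (1/θ₀, 1/θ₁, 1/θ₂)` over `B_y`:
`0 < b`, `bθ_k ≤ 1` with equality for some `k`, and `b ≤ 3`. [folklore] -/
theorem b_props {θ₀ θ₁ θ₂ : ℝ} (h₀ : 0 < θ₀) (h₁ : 0 < θ₁) (h₂ : 0 < θ₂) (hθ : θ₀ + θ₁ + θ₂ = 1) :
    0 < min (min (1 / θ₀) (1 / θ₁)) (1 / θ₂) ∧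
    min (min (1 / θ₀) (1 / θ₁)) (1 / θ₂) * θ₀ ≤ 1 ∧ min (min (1 / θ₀) (1 / θ₁)) (1 / θ₂) * θ₁ ≤ 1 ∧
    min (min (1 / θ₀) (1 / θ₁)) (1 / θ₂) * θ₂ ≤ 1 ∧
    (min (min (1 / θ₀) (1 / θ₁)) (1 / θ₂) * θ₀ = 1 ∨ min (min (1 / θ₀) (1 / θ₁)) (1 / θ₂) * θ₁ = 1 ∨
      min (min (1 / θ₀) (1 / θ₁)) (1 / θ₂) * θ₂ = 1) ∧
    min (min (1 / θ₀) (1 / θ₁)) (1 / θ₂) ≤ 3 := by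
  set m := min (min (1 / θ₀) (1 / θ₁)) (1 / θ₂) with hm
  have e0 : 1 / θ₀ * θ₀ = 1 := by field_simp
  have e1 : 1 / θ₁ * θ₁ = 1 := by field_simp
  have e2 : 1 / θ₂ * θ₂ = 1 := by field_simp
  have m0 : m ≤ 1 / θ₀ := (min_le_left _ _).trans (min_le_left _ _)
  have m1 : m ≤ 1 / θ₁ := (min_le_left _ _).trans (min_le_right _ _)
  have m2 : m ≤ 1 / θ₂ := min_le_right _ _
  refine ⟨lt_min (lt_min (by positivity) (by positivity)) (by positivity),
    e0 ▸ mul_le_mul_of_nonneg_right m0 h₀.le, e1 ▸ mul_le_mul_of_nonneg_right m1 h₁.le,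
    e2 ▸ mul_le_mul_of_nonneg_right m2 h₂.le, ?_, ?_⟩
  · rcases min_choice (min (1 / θ₀) (1 / θ₁)) (1 / θ₂) with h | h
    · rcases min_choice (1 / θ₀) (1 / θ₁) with h' | h'
      · exact Or.inl (by rw [hm, h, h', e0])
      · exact Or.inr (Or.inl (by rw [hm, h, h', e1]))
    · exact Or.inr (Or.inr (by rw [hm, h, e2]))
  · by_contra h
    push Not at h
    obtain ⟨a01, a2⟩ := lt_min_iff.mp h
    obtain ⟨a0, a1⟩ := lt_min_iff.mp a01
    have b0 := (lt_div_iff₀ h₀).mp a0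
    have b1 := (lt_div_iff₀ h₁).mp a1
    have b2 := (lt_div_iff₀ h₂).mp a2
    linarith

/-- On the closed fibre `0 ≤ y ≤ min (1/θ_k)` the box coordinates lie in `[0,1]`. [folklore] -/
theorem box_nonneg {θ₀ θ₁ θ₂ y : ℝ} (h₀ : 0 < θ₀) (h₁ : 0 < θ₁) (h₂ : 0 < θ₂) (hy : 0 ≤ y)
    (hyb : y ≤ min (min (1 / θ₀) (1 / θ₁)) (1 / θ₂)) :
    (0 ≤ 1 - y * θ₀ ∧ 0 ≤ 1 - y * θ₁ ∧ 0 ≤ 1 - y * θ₂) ∧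
      0 ≤ (1 - y * θ₀) * (1 - y * θ₁) * (1 - y * θ₂) ∧
      (1 - y * θ₀) * (1 - y * θ₁) * (1 - y * θ₂) ≤ 1 := by
  have m0 : y ≤ 1 / θ₀ := hyb.trans ((min_le_left _ _).trans (min_le_left _ _))
  have m1 : y ≤ 1 / θ₁ := hyb.trans ((min_le_left _ _).trans (min_le_right _ _))
  have m2 : y ≤ 1 / θ₂ := hyb.trans (min_le_right _ _)
  rw [le_div_iff₀ h₀] at m0
  rw [le_div_iff₀ h₁] at m1
  rw [le_div_iff₀ h₂] at m2
  have t0 : 0 ≤ 1 - y * θ₀ := by linarith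
  have t1 : 0 ≤ 1 - y * θ₁ := by linarith
  have t2 : 0 ≤ 1 - y * θ₂ := by linarith
  have a : 1 - y * θ₀ ≤ 1 := by have := mul_nonneg hy h₀.le; linarith
  have b : 1 - y * θ₁ ≤ 1 := by have := mul_nonneg hy h₁.le; linarith
  have c : 1 - y * θ₂ ≤ 1 := by have := mul_nonneg hy h₂.le; linarith
  exact ⟨⟨t0, t1, t2⟩, by positivity, mul_le_one₀ (mul_le_one₀ a t1 b) t2 c⟩

/-- A point of the open fibre lies below the upper bound. [folklore] -/
theorem le_b_of_lt {θ₀ θ₁ θ₂ y : ℝ} (h₀ : 0 < θ₀) (h₁ : 0 < θ₁) (h₂ : 0 < θ₂) (hy₀ : y * θ₀ < 1)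
    (hy₁ : y * θ₁ < 1) (hy₂ : y * θ₂ < 1) : y ≤ min (min (1 / θ₀) (1 / θ₁)) (1 / θ₂) := by
  refine le_min (le_min ?_ ?_) ?_
  · rw [le_div_iff₀ h₀]; exact hy₀.le
  · rw [le_div_iff₀ h₁]; exact hy₁.le
  · rw [le_div_iff₀ h₂]; exact hy₂.le

/-- The open band, read in the original coordinates, is the chart domain `W`. [folklore] -/
theorem mem_W_iff (w : Fin 4 → ℝ) :
    ((0 < w 0 ∧ 0 < w 1 ∧ w 0 + w 1 < 1 ∧ 0 < w 3 ∧ w 3 < 1) ∧ 0 < w 2 ∧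
      w 2 < min (min (1 / (1 - w 0 - w 1)) (1 / w 0)) (1 / w 1)) ↔
    (0 < w 0 ∧ 0 < w 1 ∧ w 0 + w 1 < 1 ∧ 0 < w 2 ∧ w 2 * (1 - w 0 - w 1) < 1 ∧ w 2 * w 0 < 1 ∧
      w 2 * w 1 < 1 ∧ 0 < w 3 ∧ w 3 < 1) := by
  constructor
  · rintro ⟨⟨h0, h1, h01, hv0, hv1⟩, hy, hyb⟩
    obtain ⟨a01, a2⟩ := lt_min_iff.mp hyb
    obtain ⟨a0, a1⟩ := lt_min_iff.mp a01
    exact ⟨h0, h1, h01, hy, (lt_div_iff₀ (by linarith)).mp a0, (lt_div_iff₀ h0).mp a1,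
      (lt_div_iff₀ h1).mp a2, hv0, hv1⟩
  · rintro ⟨h0, h1, h01, hy, hy0, hy1, hy2, hv0, hv1⟩
    refine ⟨⟨h0, h1, h01, hv0, hv1⟩, hy, lt_min (lt_min ?_ ?_) ?_⟩
    · exact (lt_div_iff₀ (by linarith)).mpr hy0
    · exact (lt_div_iff₀ h0).mpr hy1
    · exact (lt_div_iff₀ h1).mpr hy2

end CornerY

/-- **The fibre derivative of `c₂` and its bound** (sub-goal `cornerStokesYFibreDeriv` of the
corner Stokes `y`-move, registered as the differentiability/integrability input of rule (3) in
`cornerStokesYAux` / `cornerStokesY`): at an interior point of a `y`-fibre, `F` has a derivative of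
size at most `9^{3s}(1000 s + 3x)`. [cite: KontsevichZagier2001, §1.2 rule (3)] -/
theorem cornerStokesYFibreDeriv : ∀ (x s θ₀ θ₁ θ₂ v y : ℝ), 2 ≤ x → 3 ≤ s →
    0 < θ₀ → 0 < θ₁ → 0 < θ₂ → θ₀ + θ₁ + θ₂ = 1 → 0 < y → y * θ₀ < 1 → y * θ₁ < 1 → y * θ₂ < 1 →
    0 < v → v < 1 →
    ∀ (Zf Sf M0f M1f M2f F : ℝ → ℝ),
    (∀ a, Zf a = ((1 - a * θ₀) * (1 - a * θ₁) * (1 - a * θ₂)) ^ ((1:ℝ) / 3)) →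
    (∀ a, Sf a = 1 - a * (θ₀ * θ₁ + θ₀ * θ₂ + θ₁ * θ₂) + a ^ 2 * (θ₀ * θ₁ * θ₂)) →
    (∀ a, M0f a = (1 - a * θ₀) ^ x * (1 - a * θ₁) ^ (x - 2 / 3) * (1 - a * θ₂) ^ (x - 1 / 3)) →
    (∀ a, M1f a = (1 - a * θ₀) ^ (x - 1 / 3) * (1 - a * θ₁) ^ x * (1 - a * θ₂) ^ (x - 2 / 3)) →
    (∀ a, M2f a = (1 - a * θ₀) ^ (x - 2 / 3) * (1 - a * θ₁) ^ (x - 1 / 3) * (1 - a * θ₂) ^ x) →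
    (∀ a, F a = v ^ (3 * x - 1) * (1 - v * Zf a) ^ (3 * s - 1) *
      ((1 + Zf a + Zf a ^ 2) / Sf a) ^ (3 * s) * (θ₀ * θ₁ * θ₂) ^ (s - 1) *
      (θ₀ * M0f a + θ₁ * M1f a + θ₂ * M2f a)) →
    ∃ D, HasDerivAt F D y ∧ |D| ≤ (9:ℝ) ^ (3 * s) * (1000 * s + 3 * x) :=
  fun _ _ _ _ _ _ _ hx hs h₀ h₁ h₂ hθ hy hy₀ hy₁ hy₂ hv₀ hv₁ Zf Sf M0f M1f M2f F hZf hSf hM0f hM1f hM2f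
      hF =>
    CornerY.fibre hx hs h₀ h₁ h₂ hθ hy hy₀ hy₁ hy₂ hv₀ hv₁ Zf Sf M0f M1f M2f F hZf hSf hM0f hM1f hM2f hF

end Summit.KontsevichZagierPeriods.TerasomaMultiplication.MultiplicationAccessible
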